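import Literature.Computability.Cryptography.RegevReductionStepSplit
import Literature.Computability.QuantumComplexity.TidyBlockFn
import Literature.Computability.QuantumComplexity.CoinFamilyKernel
import HarnessLib

/-!
# Regev 2009, Lemma 3.3 in machine form: the `CVP` family's failure probability IS the tidy block's error

Topic `Computability/Cryptography` (family `pqc`), sequel of `RegevReductionStepSplit.lean` (the split of
the iterative step, Lemma 3.3, into its classical half A_cvp = `regev2009_lemma_3_4_cvpFamily` — Lemma
3.4, a uniform family `R` answering the closest-dual-vector table `CVPOracle.answerTable I c` on the
query strings `CVPOracle.query I ρ k y c`, its failure measured by `CVPOracle.failProb` — and its quantum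
half A_q14 = `regev2009_lemma_3_14_stepFamily` — Lemma 3.14, whose sampler calls `R` through the
function-valued tidy block of `QuantumComplexity/TidyBlockFn.lean` and pays, by the weighted form of
BBBV 1997 Thm. 4.14 (`TidyBlockFn.normSq_tidyCirc_sub_idealFn_le`), `4 Σ_q errFn(q) · w(q)` in squared
norm per call). This file closes the seam between the two halves: the quantity A_cvp bounds and the
quantity the substitution theorem consumes are THE SAME number.

* `UniformQCircuitFamily.kernelProb_eq_sum_ψD` — the output statistics of a uniform family on `x` as a
  Born sum over the state `TidyBlock.ψD (R.circ |x|) x` the tidy block runs on;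
* **`UniformQCircuitFamily.errFn_add_kernelProb_eq_one`** — for an answer width `ℓ` that fits on the
  wires, `errFn f (R.circ |x|) x + Pr[R on x prints f(x) as a prefix] = 1`: the Born weight of the
  outcomes whose first `ℓ` wires differ from `f x` (BBBV's error of the subroutine on the classical
  query `x`) is exactly the probability that the measured output string does not start with `f x`;
  `errFn_le_one_sub_kernelProb` (no fitting hypothesis), `errFn_le_one_sub_kernelProb_of_prefix`
  (a shorter target only helps);
* **`Regev2009.CVPOracle.errFn_answerFn_le_failProb`** — for in-range query data `c` and every answer
  width `ℓ ≤ |answerTable I c|`, the tidy-block error of `R.circ |query|` for the ideal answer function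
  `CVPOracle.answerFn I ρ k y |query| ℓ` (`RegevCVPOracleFn.lean`) at the query string of `c` is at most
  `CVPOracle.failProb R I ρ k y c`; **`errFn_answerFn_eq_failProb`** — equality at the full width when
  the table fits on `R`'s wires.

* **`Regev2009.CVPOracle.length_answerTable_le_length_query`** — the WIDTH CLAUSE of
  `CVPOracle.Admissible` at work: if the requested answer width is at most the grid exponent
  (`b_c ≤ ℓ_R`), the answer table (`n·b_c` bits) is no longer than the query string (which contains
  the `n·ℓ_R`-bit residue table) — so it fits on the input wires of whatever circuit is run on the
  query, and **`errFn_answerFn_eq_failProb_of_admissible`**: for ADMISSIBLE data the full-width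
  tidy-block error IS `failProb`, with no fitting hypothesis.

* **`Regev2009.CVPOracle.tsum_mul_failProb_le_weightedFail_add`** — the split of the query average
  into the charged (admissible) part and the inadmissible mass:
  `E_{c∼w}[failProb c] ≤ weightedFail R I ρ k y d w + w{c | ¬Admissible I d c}` (in `ℝ≥0∞`).

* **`Regev2009.CVPOracle.failProb_eq_one_of_wires_lt`** / `failProb_eq_one_of_width_gt` — the
  NECESSITY of the width clause, kernel-checked: whatever the family `R`, on data whose answer table is
  longer than the wires of `R.circ |query|` (in particular whenever `n·b_c > |query| + ancillas`) the
  failure probability is exactly `1` — the mechanism by which the first filing of A_cvp (without the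
  clause) was unsatisfiable.

So the successor proving A_q14 applies `TidyBlockFn.normSq_tidyCirc_sub_idealFn_le` with
`fn := CVPOracle.answerFn …` and bounds its right-hand side by `4 · E_w[1_adm · failProb]` — the
`weightedFail` of A_q14 — with no adapter. Everything is proved; no named fact is introduced.

## References

* O. Regev, *On lattices, learning with errors, random linear codes, and cryptography*, J. ACM 56
  (2009), art. 34; author's version arXiv:2401.03703, Lemma 3.3 (proof: Lemma 3.4 then Lemma 3.14),
  Lemma 3.14 (proof: "using the CVP oracle, we can recover `x` … uncompute the first register")
  [Regev2009].
* C. H. Bennett, E. Bernstein, G. Brassard, U. Vazirani, *Strengths and weaknesses of quantum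
  computing*, SIAM J. Comput. 26 (1997) 1510–1523, Def. 4.12 (error of a subroutine on an input),
  Thm. 4.14 [BennettBernsteinBrassardVazirani1997].
* M. A. Nielsen, I. L. Chuang, *Quantum Computation and Quantum Information*, CUP 2010, §2.2.5
  (Born rule for a computational-basis measurement) [NielsenChuang2010].
-/

noncomputable section

namespace Literature.Computability.Cryptography

open _root_.Computability Literature.Computability.Complexity Literature.Computability.QuantumComplexity
  Literature.Algebra.EuclideanLattices

/-! ### The output statistics of a uniform family as a Born sum over the tidy block's state -/

namespace UniformQCircuitFamily

open scoped Classical in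
/-- The probability that the measured output string of `R` on `x` lies in `E`, as the Born mass of the
outcomes of `R.circ |x|` on `|x 0…0⟩` read into `E` — the state being `TidyBlock.ψD (R.circ |x|) x`, the
one the tidy block around `R.circ |x|` runs on the classical query `x`. [cite: NielsenChuang2010, §2.2.5] -/
theorem kernelProb_eq_sum_ψD (R : UniformQCircuitFamily) (x : List Bool) (E : Set (List Bool)) :
    R.kernelProb x E = ∑ z : QReg (x.length + R.family.ancillas x.length),
      if List.ofFn z ∈ E then ‖TidyBlock.ψD (R.family.circ x.length) x.get z‖ ^ 2 else 0 := by
  unfold UniformQCircuitFamily.kernelProb QCircuitFamily.kernelProb QCircuitFamily.kernel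
  exact toReal_outputPMF_map_ofFn (A := 0) _ _ _

/-- The total Born mass of the tidy block's state is `1` (unitarity). [cite: NielsenChuang2010, §2.2.5] -/
theorem sum_normSq_ψD_eq_one (R : UniformQCircuitFamily) (x : List Bool) :
    ∑ z, ‖TidyBlock.ψD (R.family.circ x.length) x.get z‖ ^ 2 = 1 :=
  QCircuit.normSq_runOn_basisState cliffordT_isUnitary_holds 0 _ _

/-- The answer register read by the tidy block, as a list: the first `ℓ` output wires, when `ℓ` fits.
[folklore] -/
theorem ofFn_ans_eq_take {K d ℓ : ℕ} (hℓ : ℓ ≤ K + d) (z : QReg (K + d)) :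
    List.ofFn (TidyBlockFn.ans (ℓ := ℓ) z) = (List.ofFn z).take ℓ := by
  apply List.ext_getElem
  · simp [Nat.min_eq_left hℓ]
  · intro i h₁ h₂
    have hi : i < ℓ := by simpa using h₁
    simp only [List.getElem_ofFn, List.getElem_take, TidyBlockFn.ans]
    rw [dif_pos (show ((⟨i, hi⟩ : Fin ℓ) : ℕ) < K + d from lt_of_lt_of_le hi hℓ)]

/-- When the answer width fits, "the answer register equals `f x`" is "the output string starts with
`f x`". [folklore] -/
theorem ans_eq_iff_prefix {K d ℓ : ℕ} (hℓ : ℓ ≤ K + d) (z : QReg (K + d)) (a : QReg ℓ) :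
    TidyBlockFn.ans z = a ↔ List.ofFn a <+: List.ofFn z := by
  constructor
  · rintro rfl
    rw [ofFn_ans_eq_take hℓ]
    exact List.take_prefix _ _
  · intro hp
    have h := List.prefix_iff_eq_take.1 hp
    rw [List.length_ofFn, ← ofFn_ans_eq_take hℓ] at h
    exact (List.ofFn_injective h).symm

/-- **The error of the subroutine is the probability of not printing the answer.** For an answer width
`ℓ` that fits on the wires of `R.circ |x|`, BBBV's error `errFn f (R.circ |x|) x` — the Born weight of the
outcomes whose first `ℓ` wires differ from `f x` — plus the probability that the measured output string
of `R` on `x` starts with `f x` is `1`. [cite: BennettBernsteinBrassardVazirani1997, Def. 4.12 and Thm. 4.14] -/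
theorem errFn_add_kernelProb_eq_one (R : UniformQCircuitFamily) (x : List Bool) {ℓ : ℕ}
    (fn : QReg x.length → QReg ℓ) (hℓ : ℓ ≤ x.length + R.family.ancillas x.length) :
    TidyBlockFn.errFn fn (R.family.circ x.length) x.get +
      R.kernelProb x {s | List.ofFn (fn x.get) <+: s} = 1 := by
  classical
  rw [kernelProb_eq_sum_ψD, TidyBlockFn.errFn, ← sum_normSq_ψD_eq_one R x, ← Finset.sum_add_distrib]
  refine Finset.sum_congr rfl fun z _ => ?_
  by_cases h : TidyBlockFn.ans z = fn x.get
  · rw [if_pos h, if_pos (show List.ofFn z ∈ {s | List.ofFn (fn x.get) <+: s} from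
      (ans_eq_iff_prefix hℓ z _).1 h), zero_add]
  · rw [if_neg h, if_neg (show List.ofFn z ∉ {s | List.ofFn (fn x.get) <+: s} from
      fun h' => h ((ans_eq_iff_prefix hℓ z _).2 h')), add_zero]

/-- The error of the subroutine is at most `1`. [folklore] -/
theorem errFn_le_one (R : UniformQCircuitFamily) (x : List Bool) {ℓ : ℕ} (fn : QReg x.length → QReg ℓ) :
    TidyBlockFn.errFn fn (R.family.circ x.length) x.get ≤ 1 := by
  classical
  rw [TidyBlockFn.errFn, ← sum_normSq_ψD_eq_one R x]
  exact Finset.sum_le_sum fun z _ => by split_ifs <;> [positivity; exact le_rfl]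

/-- **The error of the subroutine is at most the probability of not printing the answer** — with no
hypothesis on the width: when the answer does not fit on the wires it is never printed.
[cite: BennettBernsteinBrassardVazirani1997, Def. 4.12 and Thm. 4.14] -/
theorem errFn_le_one_sub_kernelProb (R : UniformQCircuitFamily) (x : List Bool) {ℓ : ℕ}
    (fn : QReg x.length → QReg ℓ) :
    TidyBlockFn.errFn fn (R.family.circ x.length) x.get ≤
      1 - R.kernelProb x {s | List.ofFn (fn x.get) <+: s} := by
  classical
  by_cases hℓ : ℓ ≤ x.length + R.family.ancillas x.length
  · rw [← errFn_add_kernelProb_eq_one R x fn hℓ, add_sub_cancel_right]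
  · have h0 : R.kernelProb x {s | List.ofFn (fn x.get) <+: s} = 0 := by
      rw [kernelProb_eq_sum_ψD]
      refine Finset.sum_eq_zero fun z _ => if_neg fun hp => hℓ ?_
      have h := List.IsPrefix.length_le (show List.ofFn (fn x.get) <+: List.ofFn z from hp)
      simpa using h
    rw [h0, sub_zero]
    exact errFn_le_one R x fn

/-- A shorter printed target is only easier: if `f x` is a prefix of `t`, the error of the subroutine
for `f` is at most the probability that `R` on `x` does not print `t`. [folklore] -/
theorem errFn_le_one_sub_kernelProb_of_prefix (R : UniformQCircuitFamily) (x : List Bool) {ℓ : ℕ}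
    (fn : QReg x.length → QReg ℓ) {t : List Bool} (ht : List.ofFn (fn x.get) <+: t) :
    TidyBlockFn.errFn fn (R.family.circ x.length) x.get ≤ 1 - R.kernelProb x {s | t <+: s} := by
  classical
  have hmono : R.kernelProb x {s | t <+: s} ≤ R.kernelProb x {s | List.ofFn (fn x.get) <+: s} := by
    rw [kernelProb_eq_sum_ψD, kernelProb_eq_sum_ψD]
    refine Finset.sum_le_sum fun z _ => ?_
    by_cases h : List.ofFn z ∈ {s | t <+: s}
    · rw [if_pos h, if_pos (show List.ofFn z ∈ {s | List.ofFn (fn x.get) <+: s} from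
        ht.trans (show t <+: List.ofFn z from h))]
    · rw [if_neg h]
      split_ifs <;> positivity
  exact (errFn_le_one_sub_kernelProb R x fn).trans (by linarith)

end UniformQCircuitFamily

/-! ### The seam of the iterative step: `failProb` is the tidy block's `errFn` -/

namespace Regev2009

namespace CVPOracle

/-- The truncated answer table as the list of an answer register. [folklore] -/
theorem ofFn_getD_eq_take (t : List Bool) {ℓ : ℕ} (hℓ : ℓ ≤ t.length) :
    List.ofFn (fun i : Fin ℓ => t.getD (i : ℕ) false) = t.take ℓ := by
  apply List.ext_getElem
  · simp [Nat.min_eq_left hℓ]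
  · intro i h₁ h₂
    have hi : i < ℓ := by simpa using h₁
    simp only [List.getElem_ofFn, List.getElem_take]
    exact List.getD_eq_getElem _ _ (lt_of_lt_of_le hi hℓ)

/-- **The seam between Lemma 3.4 and Lemma 3.14 in machine form.** For in-range query data `c` and
every answer width `ℓ` up to the width of the answer table, the error (in BBBV's sense, `TidyBlockFn.errFn`)
of the circuit `R.circ |query|` for the ideal answer function `CVPOracle.answerFn I ρ k y |query| ℓ` at
the query string of `c` is at most the failure probability `CVPOracle.failProb R I ρ k y c` that A_cvp
(`regev2009_lemma_3_4_cvpFamily`) bounds on average over the batch — so the weighted substitution bound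
`TidyBlockFn.normSq_tidyCirc_sub_idealFn_le` is fed by A_cvp directly.
[cite: Regev2009, Lemma 3.3 (proof) and Lemma 3.14 (proof)] [cite: BennettBernsteinBrassardVazirani1997, Thm. 4.14] -/
theorem errFn_answerFn_le_failProb (R : UniformQCircuitFamily) (I : LatticeInstance) (ρ : ℚ) (k : ℕ)
    (y : List Bool) {c : QData I.n} (hc : InRange c) {ℓ : ℕ} (hℓ : ℓ ≤ (answerTable I c).length) :
    TidyBlockFn.errFn (answerFn I ρ k y (query I ρ k y c).length ℓ)
        (R.family.circ (query I ρ k y c).length) (query I ρ k y c).get ≤ failProb R I ρ k y c := by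
  have ht : List.ofFn (answerFn I ρ k y (query I ρ k y c).length ℓ (query I ρ k y c).get) <+:
      answerTable I c := by
    rw [answerFn_query I ρ k y ℓ hc, ofFn_getD_eq_take _ hℓ]
    exact List.take_prefix _ _
  exact UniformQCircuitFamily.errFn_le_one_sub_kernelProb_of_prefix R _ _ ht

/-- **Equality at the full width, when the table fits on the wires**: the tidy-block error of
`R.circ |query|` for the full ideal answer function at the query string of in-range data `c` IS
`failProb R I ρ k y c`. [cite: Regev2009, Lemma 3.3 (proof)] [cite: BennettBernsteinBrassardVazirani1997, Def. 4.12] -/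
theorem errFn_answerFn_eq_failProb (R : UniformQCircuitFamily) (I : LatticeInstance) (ρ : ℚ) (k : ℕ)
    (y : List Bool) {c : QData I.n} (hc : InRange c)
    (hfit : (answerTable I c).length ≤ (query I ρ k y c).length + R.family.ancillas (query I ρ k y c).length) :
    TidyBlockFn.errFn (answerFn I ρ k y (query I ρ k y c).length (answerTable I c).length)
        (R.family.circ (query I ρ k y c).length) (query I ρ k y c).get = failProb R I ρ k y c := by
  have h := UniformQCircuitFamily.errFn_add_kernelProb_eq_one R (query I ρ k y c)
    (answerFn I ρ k y (query I ρ k y c).length (answerTable I c).length) hfit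
  rw [answerFn_query I ρ k y _ hc, ofFn_getD_eq_take _ le_rfl, List.take_length] at h
  rw [failProb, ← h, add_sub_cancel_right]

/-! ### The width clause of `Admissible`: the answer fits on the wires -/

/-- The residue table has `n · ℓ` bits. [folklore] -/
theorem length_table {n : ℕ} (ℓ : ℕ) (s : Fin n → ℕ) : (table ℓ s).length = n * ℓ := by
  unfold table
  rw [List.length_flatten, List.map_ofFn, List.sum_ofFn]
  simp [Finset.sum_const, Finset.card_univ, Fintype.card_fin]

/-- **The width clause at work**: if the requested answer width is at most the grid exponent
(`b_c ≤ ℓ_R`, the middle conjunct of `CVPOracle.Admissible`), the answer table — `n·b_c` bits — is no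
longer than the query string, which carries the `n·ℓ_R`-bit residue table verbatim: the answer fits on
the input wires of any circuit run on the query. (Without the clause, data with `b_c` exponential in the
query length — `b_c` is written in binary — would ask a polynomial-size family to print more bits than
it has wires.) [cite: Regev2009, Lemma 3.14 (proof: "Let R ≥ 2^{3n}λ_n(L*) be a large enough integer … log R is polynomial in the input size")] -/
theorem length_answerTable_le_length_query (I : LatticeInstance) (ρ : ℚ) (k : ℕ) (y : List Bool)
    {c : QData I.n} (hw : c.2.2 ≤ c.2.1) : (answerTable I c).length ≤ (query I ρ k y c).length := by
  rw [length_answerTable, query_eq_append, List.length_append, length_table]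
  exact (Nat.mul_le_mul_left _ hw).trans (Nat.le_add_left _ _)

/-- **For admissible data, the full-width tidy-block error IS the failure probability** — no fitting
hypothesis: the width clause of `Admissible` puts the whole answer table on the input wires of
`R.circ |query|`. This is the form in which A_cvp (`regev2009_lemma_3_4_cvpFamily`, which bounds
`failProb` on admissible data) feeds the weighted substitution bound
`TidyBlockFn.normSq_tidyCirc_sub_idealFn_le` in the proof of A_q14.
[cite: Regev2009, Lemma 3.3 (proof)] [cite: BennettBernsteinBrassardVazirani1997, Def. 4.12, Thm. 4.14] -/
theorem errFn_answerFn_eq_failProb_of_admissible (R : UniformQCircuitFamily) (I : LatticeInstance) (ρ : ℚ)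
    (k : ℕ) (y : List Bool) {d : ℝ} {c : QData I.n} (hc : Admissible I d c) :
    TidyBlockFn.errFn (answerFn I ρ k y (query I ρ k y c).length (answerTable I c).length)
        (R.family.circ (query I ρ k y c).length) (query I ρ k y c).get = failProb R I ρ k y c :=
  errFn_answerFn_eq_failProb R I ρ k y hc.1
    ((length_answerTable_le_length_query I ρ k y hc.2.1).trans (Nat.le_add_right _ _))

/-- The inequality form at every width up to the table's, for admissible data. [cite: Regev2009, Lemma 3.3 (proof)] -/
theorem errFn_answerFn_le_failProb_of_admissible (R : UniformQCircuitFamily) (I : LatticeInstance) (ρ : ℚ)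
    (k : ℕ) (y : List Bool) {d : ℝ} {c : QData I.n} (hc : Admissible I d c) {ℓ : ℕ}
    (hℓ : ℓ ≤ (answerTable I c).length) :
    TidyBlockFn.errFn (answerFn I ρ k y (query I ρ k y c).length ℓ)
        (R.family.circ (query I ρ k y c).length) (query I ρ k y c).get ≤ failProb R I ρ k y c :=
  errFn_answerFn_le_failProb R I ρ k y hc.1 hℓ

/-! ### Charged and uncharged queries -/

open scoped ENNReal in
/-- **Splitting the query average**: under any law `w` of the query data, the mean failure of `R` is at
most the weighted failure on ADMISSIBLE data (the quantity A_q14 is stated with and A_cvp bounds) plus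
the `w`-mass of inadmissible data (for Regev's sampler: dual points beyond the promise distance, a
Gaussian tail — Lemma 2.5 — which goes into `ν'`). [cite: Regev2009, Lemma 3.14 (proof) and Lemma 2.5] [cite: BennettBernsteinBrassardVazirani1997, Thm. 3.3] -/
theorem tsum_mul_failProb_le_weightedFail_add (R : UniformQCircuitFamily) (I : LatticeInstance) (ρ : ℚ)
    (k : ℕ) (y : List Bool) (d : ℝ) (w : PMF (QData I.n)) :
    ∑' c, w c * ENNReal.ofReal (failProb R I ρ k y c) ≤
      weightedFail R I ρ k y d w + w.toOuterMeasure {c | ¬ Admissible I d c} := by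
  classical
  rw [weightedFail, PMF.toOuterMeasure_apply, ← ENNReal.tsum_add]
  refine ENNReal.tsum_le_tsum fun c => ?_
  by_cases hc : Admissible I d c
  · rw [Set.indicator_of_mem (show c ∈ {c | Admissible I d c} from hc),
      Set.indicator_of_notMem (show c ∉ {c | ¬ Admissible I d c} from fun h => h hc), add_zero]
  · rw [Set.indicator_of_notMem (show c ∉ {c | Admissible I d c} from hc),
      Set.indicator_of_mem (show c ∈ {c | ¬ Admissible I d c} from hc), ENNReal.ofReal_zero, mul_zero,
      zero_add]
    calc w c * ENNReal.ofReal (failProb R I ρ k y c) ≤ w c * 1 :=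
        mul_le_mul' le_rfl (ENNReal.ofReal_le_one.2 (failProb_le_one R I ρ k y c))
      _ = w c := mul_one _

/-! ### Why the width clause is needed: no family prints more bits than it has wires -/

/-- **Certain failure beyond the wires.** Whatever the family `R`: if the answer table of `c` is longer
than the measured wire string of `R.circ |query|` (input plus ancilla wires), `R` never prints it —
`failProb = 1`. [folklore] -/
theorem failProb_eq_one_of_wires_lt (R : UniformQCircuitFamily) (I : LatticeInstance) (ρ : ℚ) (k : ℕ)
    (y : List Bool) (c : QData I.n)
    (h : (query I ρ k y c).length + R.family.ancillas (query I ρ k y c).length < (answerTable I c).length) :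
    failProb R I ρ k y c = 1 := by
  classical
  have h0 : R.kernelProb (query I ρ k y c) {s | answerTable I c <+: s} = 0 := by
    rw [UniformQCircuitFamily.kernelProb_eq_sum_ψD]
    refine Finset.sum_eq_zero fun z _ => if_neg fun hp => ?_
    have hl := List.IsPrefix.length_le (show answerTable I c <+: List.ofFn z from hp)
    rw [List.length_ofFn] at hl
    omega
  rw [failProb, h0, sub_zero]

/-- **The width form**: if the requested answer width `b_c` makes the `n·b_c`-bit table longer than the
wires of `R.circ |query|`, failure is certain. Since `b_c` enters the query length only through its
binary numeral while a uniform family has polynomially many wires, WITHOUT the clause `b_c ≤ ℓ_R` of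
`CVPOracle.Admissible` every family fails with certainty on some admissible-by-distance data (e.g. the
point `0` with a huge requested width) — the reason the clause is part of admissibility. [folklore] -/
theorem failProb_eq_one_of_width_gt (R : UniformQCircuitFamily) (I : LatticeInstance) (ρ : ℚ) (k : ℕ)
    (y : List Bool) (c : QData I.n)
    (h : (query I ρ k y c).length + R.family.ancillas (query I ρ k y c).length < I.n * c.2.2) :
    failProb R I ρ k y c = 1 :=
  failProb_eq_one_of_wires_lt R I ρ k y c (by rwa [length_answerTable])

end CVPOracle

end Regev2009

end Literature.Computability.Cryptography

end
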